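import Summits.BirchSwinnertonDyer.BirchSwinnertonDyer.Theorems.EisensteinDepletionAtTwoStarOptBNSFFormalSqrtCore
import Literature.NumberTheory.EllipticCurves.FormalGroupMultiplication
import Mathlib.RingTheory.PowerSeries.Binomial
import HarnessLib

/-!
# The formal square root at `2`, III: odd primes and the rational statement (line `nsf`, crux `StarOptBNSF`, stmt-BirchSwinnertonDyer-27047)

**`exists_formalSqrt_half_integral`** (stub `stub_formalSqrtAtTwo` of line `nsf` v14): for a globally minimal
elliptic `W/ℚ` and `x₁` with `HasRationalTwoTorsionX W x₁` and `TwoTorsionRamifiedAtTwo x₁` (`v₂(x₁) < 0`) there is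
`B ∈ ℚ⟦z⟧` with `B(0) = 1`, `B² = formalXMulSq W − x₁ z²` and `2B ∈ ℤ⟦z⟧` (every coefficient is `k/2`, `k ∈ ℤ`).
The square root is the binomial series `(1 + g)^{1/2}`, `g = X − 1 − x₁z²` (Mathlib `PowerSeries.binomialSeries`);
at `p = 2` the bound is file II (`isPadicInt_two_mul`); at an ODD prime `p` the `2`-torsion abscissa is
`p`-integral (`4x₁³ + b₂x₁² + 2b₄x₁ + b₆ = 0`) and the coefficients of `B`, computed from `B² = X − x₁z²` by
halving, are `p`-integral by induction (`isPadicInt_sqrt_odd`); a rational number integral at every prime is an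
integer.  BSD is not proved by this file; nothing here reads `r_an`.
-/

set_option linter.dupNamespace false
set_option autoImplicit false

noncomputable section

open PowerSeries
open Literature.NumberTheory.EllipticCurves

namespace Summit.BirchSwinnertonDyer.BirchSwinnertonDyer.Theorems.DepletionAtTwo.FormalSqrt

/-! ### Odd primes: the square root is `p`-integral for free -/

section OddPrime

variable {p : ℕ} [Fact p.Prime] (W : WeierstrassCurve ℚ_[p]) [hW : W.IsIntegral ℤ_[p]]

omit hW in
/-- The `2`-division relation `4e³ + b₂e² + 2b₄e + b₆ = 0` at a point of order `2` (any `p`).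
[Silverman AEC III.1, III.2.3(d)] [folklore] -/
theorem two_division_relation_p {e f : ℚ_[p]} (heq : W.toAffine.Equation e f)
    (htor : 2 * f + W.a₁ * e + W.a₃ = 0) : 4 * e ^ 3 + W.b₂ * e ^ 2 + 2 * W.b₄ * e + W.b₆ = 0 := by
  rw [WeierstrassCurve.Affine.equation_iff] at heq
  have h1 : (2 * f + W.a₁ * e + W.a₃) ^ 2 = 0 := by rw [htor]; ring
  simp only [WeierstrassCurve.b₂, WeierstrassCurve.b₄, WeierstrassCurve.b₆]
  linear_combination h1 - 4 * heq

/-- At an ODD prime `p` every `2`-torsion abscissa is `p`-integral (`4x₁ ∈ ℤ`, read at `p`).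
[Silverman AEC VII.3.4 / VIII.7.1 (torsion points have integral coordinates away from small primes)]
[folklore] -/
theorem norm_twoTorsionX_le_one (hp : p ≠ 2) {e f : ℚ_[p]} (heq : W.toAffine.Equation e f)
    (htor : 2 * f + W.a₁ * e + W.a₃ = 0) : ‖e‖ ≤ 1 := by
  by_contra hlt'
  have hlt : 1 < ‖e‖ := not_le.mp hlt'
  obtain ⟨hb₂, hb₄, hb₆⟩ : ‖W.b₂‖ ≤ 1 ∧ ‖W.b₄‖ ≤ 1 ∧ ‖W.b₆‖ ≤ 1 := by
    have hV := W.eq_map_integralModel (p := p)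
    refine ⟨?_, ?_, ?_⟩
    · rw [← hV, WeierstrassCurve.map_b₂]; exact PadicInt.norm_le_one _
    · rw [← hV, WeierstrassCurve.map_b₄]; exact PadicInt.norm_le_one _
    · rw [← hV, WeierstrassCurve.map_b₆]; exact PadicInt.norm_le_one _
  have hrel := two_division_relation_p W heq htor
  have hp' : (p : ℕ).Coprime 2 := (Nat.coprime_primes (Fact.out) Nat.prime_two).mpr hp
  have h4 : ‖(4 : ℚ_[p])‖ = 1 := by
    have : ‖((4 : ℕ) : ℚ_[p])‖ = 1 :=
      Padic.norm_natCast_eq_one_iff.mpr (by simpa using hp'.pow_right 2)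
    simpa using this
  have h2 : ‖(2 : ℚ_[p])‖ = 1 := by
    have : ‖((2 : ℕ) : ℚ_[p])‖ = 1 := Padic.norm_natCast_eq_one_iff.mpr hp'
    simpa using this
  have h1e : 1 ≤ ‖e‖ := hlt.le
  have hkey : 4 * e ^ 3 = -(W.b₂ * e ^ 2 + 2 * W.b₄ * e + W.b₆) := by linear_combination hrel
  have hbound : ‖W.b₂ * e ^ 2 + 2 * W.b₄ * e + W.b₆‖ ≤ ‖e‖ ^ 2 := by
    have hA : ‖W.b₂ * e ^ 2‖ ≤ ‖e‖ ^ 2 := by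
      rw [norm_mul, norm_pow]; exact mul_le_of_le_one_left (by positivity) hb₂
    have hB : ‖2 * W.b₄ * e‖ ≤ ‖e‖ ^ 2 := by
      rw [norm_mul, norm_mul, h2]
      calc 1 * ‖W.b₄‖ * ‖e‖ ≤ 1 * 1 * ‖e‖ := by gcongr
        _ = ‖e‖ ^ 1 := by ring
        _ ≤ ‖e‖ ^ 2 := pow_le_pow_right₀ h1e (by norm_num)
    have hCc : ‖W.b₆‖ ≤ ‖e‖ ^ 2 := hb₆.trans (one_le_pow₀ h1e)
    refine (IsUltrametricDist.norm_add_le_max _ _).trans (max_le ?_ hCc)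
    exact (IsUltrametricDist.norm_add_le_max _ _).trans (max_le hA hB)
  have h4n : ‖4 * e ^ 3‖ = ‖e‖ ^ 3 := by rw [norm_mul, norm_pow, h4, one_mul]
  rw [hkey, norm_neg] at h4n
  have h3 : ‖e‖ ^ 3 ≤ ‖e‖ ^ 2 := h4n ▸ hbound
  have hpos : 0 < ‖e‖ ^ 2 := by positivity
  have h5 : ‖e‖ ^ 2 * ‖e‖ ≤ ‖e‖ ^ 2 * 1 := by nlinarith [h3]
  have := le_of_mul_le_mul_left h5 hpos
  linarith

/-- At an ODD prime, a square root `B` (`B(0) = 1`) of `X(z) − x₁z²` is `p`-integral: its coefficients are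
computed from `B² = X − x₁z²` by halving. [folklore] -/
theorem isPadicInt_sqrt_odd (hp : p ≠ 2) {e f : ℚ_[p]} (heq : W.toAffine.Equation e f)
    (htor : 2 * f + W.a₁ * e + W.a₃ = 0) (B : ℚ_[p]⟦X⟧) (hB0 : constantCoeff B = 1)
    (hB : B ^ 2 = W.formalXMulSq - C e * X ^ 2) : IsPadicInt B := by
  have he := norm_twoTorsionX_le_one W hp heq htor
  have hS : IsPadicInt (W.formalXMulSq - C e * X ^ 2) :=
    W.isPadicInt_formalXMulSq.sub ((IsPadicInt.powerSeries_C he).mul (IsPadicInt.powerSeries_X.pow 2))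
  have hp' : (p : ℕ).Coprime 2 := (Nat.coprime_primes (Fact.out) Nat.prime_two).mpr hp
  have h2 : ‖(2 : ℚ_[p])‖ = 1 := by
    have : ‖((2 : ℕ) : ℚ_[p])‖ = 1 := Padic.norm_natCast_eq_one_iff.mpr hp'
    simpa using this
  have hc0 : coeff 0 B = 1 := by rw [coeff_zero_eq_constantCoeff]; exact hB0
  rw [isPadicInt_iff_coeff]
  intro n
  induction n using Nat.strong_induction_on with
  | _ n ih =>
    rcases Nat.eq_zero_or_pos n with rfl | hn
    · rw [hc0, norm_one]
    · have hsq := coeff_sq_eq B hn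
      rw [hB, hc0] at hsq
      have hsum : ‖∑ i ∈ Finset.Ioo 0 n, coeff i B * coeff (n - i) B‖ ≤ 1 := by
        refine IsUltrametricDist.norm_sum_le_of_forall_le_of_nonneg zero_le_one fun i hi ↦ ?_
        obtain ⟨hi0, hin⟩ := Finset.mem_Ioo.mp hi
        rw [norm_mul]
        exact mul_le_one₀ (ih i hin) (norm_nonneg _) (ih (n - i) (by omega))
      have hlin : 2 * coeff n B =
          coeff n (W.formalXMulSq - C e * X ^ 2) - ∑ i ∈ Finset.Ioo 0 n, coeff i B * coeff (n - i) B := by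
        linear_combination -hsq
      have hnorm : ‖2 * coeff n B‖ ≤ 1 := by
        rw [hlin]
        exact (padic_norm_sub_le_max _ _).trans (max_le (isPadicInt_iff_coeff.mp hS n) hsum)
      rwa [norm_mul, h2, one_mul] at hnorm

end OddPrime

/-! ### The rational statement -/

section Rational

open Literature.NumberTheory.EllipticCurves.Greenberg1999

/-- A rational number that is `p`-integral at every prime is an integer. [folklore] -/
theorem exists_int_of_forall_norm_le_one (q : ℚ)
    (h : ∀ (p : ℕ) [Fact p.Prime], ‖(q : ℚ_[p])‖ ≤ 1) : ∃ k : ℤ, (k : ℚ) = q := by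
  by_cases hden : q.den = 1
  · exact ⟨q.num, Rat.coe_int_num_of_den_eq_one hden⟩
  · exfalso
    obtain ⟨p, hp, hpd⟩ := Nat.exists_prime_and_dvd hden
    haveI : Fact p.Prime := ⟨hp⟩
    have hq0 : q ≠ 0 := by
      rintro rfl
      exact hden Rat.den_zero
    have hnum : ¬ (p : ℤ) ∣ q.num := by
      intro hdvd
      have h1 : p ∣ q.num.natAbs := Int.natCast_dvd.mp (by simpa using hdvd)
      have h2 : p ∣ Nat.gcd q.num.natAbs q.den := Nat.dvd_gcd h1 hpd
      rw [q.reduced] at h2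
      exact hp.one_lt.ne' (Nat.dvd_one.mp h2)
    have hval : padicValRat p q ≤ -1 := by
      have hv : padicValRat p q = padicValInt p q.num - padicValNat p q.den := rfl
      rw [hv, padicValInt.eq_zero_of_not_dvd hnum]
      have := one_le_padicValNat_of_dvd (p := p) q.den_nz hpd
      omega
    have hnorm : ‖(q : ℚ_[p])‖ = (p : ℝ) ^ (-padicValRat p q) := by
      rw [Padic.eq_padicNorm, padicNorm.eq_zpow_of_nonzero hq0]
      push_cast
      rfl
    have hgt : 1 < ‖(q : ℚ_[p])‖ := by
      rw [hnorm]
      exact one_lt_zpow₀ (by exact_mod_cast hp.one_lt) (by omega)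
    exact absurd (h p) (not_le.mpr hgt)

/-- **The formal square root at `2` (stub `stub_formalSqrtAtTwo` of line `nsf`, v14).**  For a globally
minimal elliptic `W/ℚ` and a rational `2`-torsion abscissa `x₁` that is formal at `2` (`v₂(x₁) < 0`), there
is `B ∈ ℚ⟦z⟧` with `B(0) = 1`, `B² = X(z) − x₁z²` (`X = formalXMulSq`, so `B/z = √(x(z) − x₁)`), and
`2B ∈ ℤ⟦z⟧`.  The `2`-adic bound is `isPadicInt_two_mul`; odd primes are `isPadicInt_sqrt_odd`; the
square root itself is the binomial series `(1 + g)^{1/2}`, `g = X − 1 − x₁z²`.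
[Silverman AEC IV.1, VII.2.2] [folklore] -/
theorem exists_formalSqrt_half_integral (W : WeierstrassCurve ℚ) [W.IsElliptic] [W.IsGloballyMinimal]
    {x₁ : ℚ} (hx : HasRationalTwoTorsionX W x₁) (hram : TwoTorsionRamifiedAtTwo x₁) :
    ∃ B : ℚ⟦X⟧, constantCoeff B = 1 ∧ B ^ 2 = W.formalXMulSq - C x₁ * X ^ 2 ∧
      ∀ n : ℕ, ∃ k : ℤ, coeff n B = (k : ℚ) / 2 := by
  obtain ⟨y₁, hxy, htor⟩ := hx
  -- the square root as a binomial series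
  set g : ℚ⟦X⟧ := W.formalXMulSq - 1 - C x₁ * X ^ 2 with hg
  have hg0 : constantCoeff g = 0 := by
    simp [hg, WeierstrassCurve.constantCoeff_formalXMulSq]
  have hgs : HasSubst g := HasSubst.of_constantCoeff_zero' hg0
  set B₀ : ℚ⟦X⟧ := (PowerSeries.binomialSeries ℚ (1 / 2 : ℚ)).subst g with hB₀
  have hB₀sq : B₀ ^ 2 = W.formalXMulSq - C x₁ * X ^ 2 := by
    rw [hB₀, ← subst_pow hgs, sq, ← binomialSeries_add,
      show (1 / 2 : ℚ) + 1 / 2 = ((1 : ℕ) : ℚ) by norm_num, binomialSeries_nat, pow_one,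
      subst_add hgs, subst_X hgs, ← coe_substAlgHom hgs, map_one, hg]
    ring
  -- normalise the sign of the constant term
  have hc : constantCoeff B₀ = 1 ∨ constantCoeff B₀ = -1 := by
    have h1 : constantCoeff B₀ ^ 2 = 1 ^ 2 := by
      rw [← map_pow, hB₀sq, map_sub, map_mul, WeierstrassCurve.constantCoeff_formalXMulSq]
      simp
    exact eq_or_eq_neg_of_sq_eq_sq _ _ h1
  obtain ⟨B, hB0, hB⟩ : ∃ B : ℚ⟦X⟧, constantCoeff B = 1 ∧ B ^ 2 = W.formalXMulSq - C x₁ * X ^ 2 := by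
    rcases hc with h | h
    · exact ⟨B₀, h, hB₀sq⟩
    · exact ⟨-B₀, by rw [map_neg, h, neg_neg], by rw [neg_sq, hB₀sq]⟩
  refine ⟨B, hB0, hB, fun n ↦ ?_⟩
  -- integrality of `2 · coeff n B` prime by prime
  suffices hall : ∀ (p : ℕ) [Fact p.Prime], ‖((2 * coeff n B : ℚ) : ℚ_[p])‖ ≤ 1 by
    obtain ⟨k, hk⟩ := exists_int_of_forall_norm_le_one _ hall
    exact ⟨k, by rw [hk]; ring⟩
  intro p hpF
  have hp : p.Prime := hpF.out
  -- read everything in `ℚ_p`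
  set φ : ℚ →+* ℚ_[p] := algebraMap ℚ ℚ_[p] with hφ
  have hφx : ∀ q : ℚ, φ q = (q : ℚ_[p]) := fun q ↦ by rw [hφ, eq_ratCast]
  have hWp : W.baseChange ℚ_[p] = W.map φ := rfl
  set Bp : ℚ_[p]⟦X⟧ := PowerSeries.map φ B with hBpdef
  have hBp0 : constantCoeff Bp = 1 := by
    rw [hBpdef, ← coeff_zero_eq_constantCoeff_apply, coeff_map, coeff_zero_eq_constantCoeff_apply, hB0,
      map_one]
  have hBp : Bp ^ 2 = (W.baseChange ℚ_[p]).formalXMulSq - C (x₁ : ℚ_[p]) * X ^ 2 := by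
    have := congrArg (PowerSeries.map φ) hB
    rw [map_pow, map_sub, map_mul, map_pow, map_C, map_X, W.map_formalXMulSq φ, hφx] at this
    rw [hWp]; exact this
  have heqp : (W.baseChange ℚ_[p]).toAffine.Equation (x₁ : ℚ_[p]) (y₁ : ℚ_[p]) := by
    have := WeierstrassCurve.Affine.Equation.map φ hxy
    rw [hφx, hφx] at this
    exact this
  have htorp : 2 * (y₁ : ℚ_[p]) + (W.baseChange ℚ_[p]).a₁ * x₁ + (W.baseChange ℚ_[p]).a₃ = 0 := by
    have := congrArg (Rat.cast : ℚ → ℚ_[p]) htor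
    push_cast at this
    simpa [hWp, hφx] using this
  have hcoeff : coeff n Bp = ((coeff n B : ℚ) : ℚ_[p]) := by rw [hBpdef, coeff_map, hφx]
  by_cases hp2 : p = 2
  · subst hp2
    -- `p = 2`: the `2`-adic core
    have hx0 : x₁ ≠ 0 := by
      rintro rfl
      simp [TwoTorsionRamifiedAtTwo] at hram
    have he : 1 < ‖(x₁ : ℚ_[2])‖ := by
      rw [Padic.eq_padicNorm, padicNorm.eq_zpow_of_nonzero hx0]
      push_cast
      exact one_lt_zpow₀ (by norm_num) (by
        have := (twoTorsionRamifiedAtTwo_iff x₁).mp hram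
        omega)
    have hint := isPadicInt_two_mul heqp htorp he Bp hBp0 hBp
    have := isPadicInt_iff_coeff.mp hint n
    rw [coeff_C_mul, hcoeff] at this
    push_cast
    exact this
  · -- odd `p`: free
    have hint := isPadicInt_sqrt_odd (W.baseChange ℚ_[p]) hp2 heqp htorp Bp hBp0 hBp
    have h1 := isPadicInt_iff_coeff.mp hint n
    rw [hcoeff] at h1
    have h2 : ‖(2 : ℚ_[p])‖ ≤ 1 := by exact_mod_cast Padic.norm_int_le_one (p := p) 2
    push_cast
    rw [norm_mul]
    exact mul_le_one₀ h2 (norm_nonneg _) h1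

end Rational

end Summit.BirchSwinnertonDyer.BirchSwinnertonDyer.Theorems.DepletionAtTwo.FormalSqrt

end
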